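import Literature.NumberTheory.DiophantineGeometry.SubexponentialAbcWithoutRadA
import Literature.NumberTheory.DiophantineGeometry.AbcStewartYu2001PlaceBoundsProofs
import Literature.Barriers.ABC.BakerMethodBoundsThreeRoutesProofs
import HarnessLib

/-!
# Pasten–Sepúlveda-Manzo 2025, Thm 2.2, Thm 1.3 and Thm 1.6 PROVED from Evertse–Győry's
# Theorem 4.2.1 over `ℚ` (proofs)

Topic `Literature/NumberTheory/DiophantineGeometry` (family `abc`; seat lit-abc-pasten g2, cell
abc-stewartyu). Proofs-only companion (theorems only, NO new statement, NO new named fact; D-0026)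
of `SubexponentialAbcWithoutRadA.lean`: H. Pasten, R. Sepúlveda-Manzo, *On the `abc` and the `abcd`
conjectures*, Bull. Braz. Math. Soc. 56 (2025) = arXiv:2406.05083 [`PastenSepulvedaManzo2025Abcd`].

* `PastenSepulvedaManzo2025_thm_2_2_of_evertseGyory` — **Thm 2.2** (`log(c/a)/log⁎₂ c ≤
  exp(κ · (log⁎₃ R / log⁎₂ R) log R)`, `R = rad(bc)`, all `abc` triples) from the named fact
  `Dioph.evertseGyory_thm_4_2_1_rat` (Evertse–Győry Thm 4.2.1 for `K = ℚ`; Matveev + Yu), through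
  Pasten's approximation bound (`Dioph.pasten2024_thm_2_1`, `PastenApproximationBound pastenK`):
  `…_of_approximationBound` for any `K ≥ 1` with `PastenApproximationBound K`.
* `PastenSepulvedaManzo2025_thm_2_2_general` — the same bound with `rad(n)` for any multiple
  `n` of `bc` in place of `rad(bc)` (the form consumed by the `abcd` reduction of §3).
* `PastenSepulvedaManzo2025_thm_1_3_of_evertseGyory` — **Thm 1.3** (the main `abc` theorem without
  `rad(a)`) from the same single fact (`PastenSepulvedaManzo2025_thm_1_3_of_thm_2_2` of the sibling).
* `PastenSepulvedaManzo2025_thm_1_6_of_evertseGyory` — **Thm 1.6** (the `abcd` equation) from the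
  same single fact, by the printed reduction of §3 to Thm 1.3 (`abcd_key` + the complementary pair).

The printed proof of Thm 2.2 (§2): Lemma 2.1 (= EG 4.2.1) with `ξ = b/c` and the primes of `bc` as
generators gives `log(c/a)/log⁎₂ c ≤ K^m ∏ log p_j`; then AM–GM, `m ≤ M log R / log⁎₂ R` and the
monotonicity of `(K log R/t)^t`. Over the tree we follow the SAME road in the currency already
landed for Stewart–Yu 2001, Thm 2 (`AbcStewartYu2001PlaceBoundsProofs.lean`): the archimedean place
bound `Pasten.arch_bound` (`log c − log a < Θ_{bc} · log max{e, 2 log c}`,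
`Θ_{bc} = K^{ω(bc)+1} ∏_{q∣bc} log q`, `theta_zero_eq`), the estimate `log max{e, 2 log c} ≤ 2 log⁎₂ c`,
and the absorption `StewartYu2001.absorb` (`128 M² ω² log G ≤ G^{C log₃ G⋆ / log₂ G}` for any set of
primes with product `G ≥ 6`, `M = K^{ω+1} ∏ log max{4, q}` — this packages AM–GM/Jensen and
`ω ≤ 30 log G / log₂ G`), applied to the primes of `n ⊇` those of `bc` when `rad(n) ≥ 16` (where
`log₂ rad ≥ 1`, so that `C log₃ R / log₂ R · log R ≤ C · psRate R`), and a crude bound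
`2Θ_{bc} < 32 K¹⁷ ≤ exp(κ₀ psRate R)` when `rad(n) < 16` (`psRate R ≥ (log 2)/3` there). The constant is
`κ = max{C, 5 log(32 K¹⁷) + 1}`. Deviation from print: none in substance (the optimisation in `m` is
the one inside `absorb`); constants are not the paper's (none are printed).

## References

* [PastenSepulvedaManzo2025Abcd] H. Pasten, R. Sepúlveda-Manzo, arXiv:2406.05083: Lemma 2.1, Thm 2.2
  and its proof, proof of Thm 1.3 (§2).
* [EvertseGyory2015] J.-H. Evertse, K. Győry, *Unit Equations in Diophantine Number Theory*, Thm 4.2.1.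
* [StewartYu2001] C. L. Stewart, K. Yu, Duke Math. J. 108 (2001), Theorem 2 (the shape
  `G^{c log₃ G⋆/log₂ G}`; tree `StewartYu2001.absorb`).
* [Pasten2024] H. Pasten, Invent. Math. 236 (2024), Thm 2.1 (tree `Dioph.pasten2024_thm_2_1`,
  `Pasten.arch_bound`).
-/

noncomputable section

open Real Finset
open Literature.NumberTheory.DiophantineGeometry.Dioph
open Literature.NumberTheory.DiophantineGeometry.Pasten
open Literature.Barriers.ABC

namespace Literature.NumberTheory.DiophantineGeometry

/-! ### Numerics -/

/-- `0.69 < log 2`. [folklore] -/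
private theorem log_two_gt : (0.69 : ℝ) < Real.log 2 := by
  have := Real.log_two_gt_d9; linarith

/-- Auxiliary numerical/elementary step. [folklore] -/
private theorem log_sixteen_eq : Real.log 16 = 4 * Real.log 2 := by
  rw [show (16 : ℝ) = 2 ^ 4 by norm_num, Real.log_pow]; norm_num

/-- Auxiliary numerical/elementary step. [folklore] -/
private theorem log_sixteen_lt_three : Real.log (16 : ℝ) < 3 := by
  rw [log_sixteen_eq]; have := Real.log_two_lt_d9; linarith

/-- Auxiliary numerical/elementary step. [folklore] -/
private theorem exp_one_lt_log_sixteen : Real.exp 1 < Real.log (16 : ℝ) := by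
  rw [log_sixteen_eq]; have := Real.log_two_gt_d9; have := Real.exp_one_lt_d9; linarith

/-- For `R ≥ 16`: `1 ≤ log log R`. [folklore] -/
private theorem one_le_log_log {R : ℝ} (hR : 16 ≤ R) : 1 ≤ Real.log (Real.log R) := by
  have h1 : Real.exp 1 ≤ Real.log R :=
    le_trans exp_one_lt_log_sixteen.le (Real.log_le_log (by norm_num) hR)
  rw [← Real.log_exp 1]
  exact Real.log_le_log (Real.exp_pos 1) h1

/-- `logStar u > 0`. [folklore] -/
private theorem logStar_pos' (u : ℝ) : 0 < logStar u :=
  lt_of_lt_of_le one_pos (one_le_logStar u)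

/-- `Y = log max(e, 2 log c) ≤ 2 · log⁎₂ c`. [folklore] -/
private theorem log_max_exp_two_mul_le (c : ℝ) :
    Real.log (max (Real.exp 1) (2 * Real.log c)) ≤ 2 * logStar (Real.log c) := by
  have h1 : 1 ≤ logStar (Real.log c) := one_le_logStar _
  rcases le_or_gt (2 * Real.log c) (Real.exp 1) with h | h
  · rw [max_eq_left h, Real.log_exp]; linarith
  · rw [max_eq_right h.le]
    have hpos : 0 < Real.log c := by
      have := Real.exp_pos 1; linarith
    rw [Real.log_mul (by norm_num) hpos.ne']
    have hl2 := Real.log_two_lt_d9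
    have h2 : Real.log (Real.log c) ≤ logStar (Real.log c) := by
      rw [logStar_def]; exact le_max_right _ _
    linarith

/-! ### Step 1: the archimedean place bound, normalised by `log⁎₂ c` -/

/-- `log(c/a) / log⁎₂ c < 2 Θ_{bc}`. [folklore] -/
private theorem lhs_lt_two_theta {K : ℝ} (hK : 1 ≤ K) (hP : PastenApproximationBound K)
    {a b c : ℕ} (h : IsABCTriple a b c) :
    Real.log ((c : ℝ) / a) / logStar (Real.log c) < 2 * theta K b c 0 := by
  have h' := h
  obtain ⟨ha, hb, habc, hcop⟩ := h'
  have hc : 0 < c := by omega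
  have ha' : (0 : ℝ) < a := by exact_mod_cast ha
  have hc' : (0 : ℝ) < c := by exact_mod_cast hc
  have harch := arch_bound hK hP h 0
  have hbc : b.Coprime c := coprime_right_of_isABCTriple h
  have hΘ : 0 < theta K b c 0 := theta_zero_pos hK hb.ne' hc.ne' hbc
  have hm : 0 < logStar (Real.log c) := logStar_pos' _
  have hY := log_max_exp_two_mul_le (c : ℝ)
  rw [Real.log_div hc'.ne' ha'.ne', div_lt_iff₀ hm]
  calc Real.log c - Real.log a
      < theta K b c 0 * Real.log (max (Real.exp 1) (2 * Real.log c)) := harch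
    _ ≤ theta K b c 0 * (2 * logStar (Real.log c)) := mul_le_mul_of_nonneg_left hY hΘ.le
    _ = 2 * theta K b c 0 * logStar (Real.log c) := by ring

/-! ### Step 2: the radical of `bc` -/

/-- The radical of a natural number as a real product over its prime factors. [folklore] -/
private theorem radical_cast_eq_prod' (n : ℕ) :
    ((UniqueFactorizationMonoid.radical (M := ℕ) n : ℕ) : ℝ) = ∏ q ∈ n.primeFactors, (q : ℝ) := by
  rw [Nat.radical_eq_prod_primeFactors]; push_cast; rfl

/-- `rad(m) ≤ rad(n)` when `m ∣ n ≠ 0`. [folklore] -/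
private theorem radical_le_radical_of_dvd {m n : ℕ} (h : m ∣ n) (hn : n ≠ 0) :
    UniqueFactorizationMonoid.radical (M := ℕ) m ≤ UniqueFactorizationMonoid.radical (M := ℕ) n := by
  rw [Nat.radical_eq_prod_primeFactors, Nat.radical_eq_prod_primeFactors]
  exact Finset.prod_le_prod_of_subset_of_one_le' (Nat.primeFactors_mono h hn)
    fun q hq _ => (Nat.prime_of_mem_primeFactors hq).one_lt.le

/-- Auxiliary numerical/elementary step. [folklore] -/
private theorem two_le_radical {b c : ℕ} (hb : 0 < b) (hc : 2 ≤ c) :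
    2 ≤ UniqueFactorizationMonoid.radical (M := ℕ) (b * c) := by
  obtain ⟨p, hp, hpc⟩ := Nat.exists_prime_and_dvd (show c ≠ 1 by omega)
  have hbc0 : b * c ≠ 0 := by positivity
  have hmem : p ∈ (b * c).primeFactors :=
    Nat.mem_primeFactors.mpr ⟨hp, hpc.trans (dvd_mul_left c b), hbc0⟩
  rw [Nat.radical_eq_prod_primeFactors]
  have hle : p ≤ ∏ q ∈ (b * c).primeFactors, q :=
    Nat.le_of_dvd (Finset.prod_pos fun q hq => (Nat.prime_of_mem_primeFactors hq).pos)
      (Finset.dvd_prod_of_mem _ hmem)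
  exact hp.two_le.trans hle

/-! ### Step 3: small radical (`R < 16`): `2Θ < 32 K¹⁷ ≤ exp(κ₀ · psRate R)` -/

/-- Small radical: if `rad(bc) < 16` then `2Θ_{bc} < 32 K¹⁷` (`ω(bc) ≤ 16`, every
`log q < log 16 < 3`… crude). [folklore] -/
private theorem two_theta_lt_small {K : ℝ} (hK : 1 ≤ K) {b c : ℕ} (hb : 0 < b) (hc : 0 < c)
    (hbc : b.Coprime c) (hR : UniqueFactorizationMonoid.radical (M := ℕ) (b * c) < 16) :
    2 * theta K b c 0 < 32 * K ^ 17 := by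
  set S := (b * c).primeFactors with hS
  rw [theta_zero_eq K hb.ne' hc.ne' hbc]
  have hK0 : 0 ≤ K := by linarith
  -- every prime of `bc` is `< 16`, so `#S ≤ 16`
  have hsub : S ⊆ Finset.range 16 := by
    intro q hq
    rw [Finset.mem_range]
    have hqR : q ≤ UniqueFactorizationMonoid.radical (M := ℕ) (b * c) := by
      rw [Nat.radical_eq_prod_primeFactors]
      exact Nat.le_of_dvd (Finset.prod_pos fun r hr => (Nat.prime_of_mem_primeFactors hr).pos)
        (Finset.dvd_prod_of_mem _ hq)
    omega
  have hcard : S.card + 1 ≤ 17 := by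
    have := Finset.card_le_card hsub; rw [Finset.card_range] at this; omega
  have h1 : K ^ (S.card + 1) ≤ K ^ 17 := pow_le_pow_right₀ hK hcard
  -- `∏ log q ≤ ∏ q = R < 16`
  have hlog0 : ∀ q ∈ S, 0 ≤ Real.log (q : ℝ) := fun q hq =>
    Real.log_nonneg (by exact_mod_cast (Nat.prime_of_mem_primeFactors hq).one_lt.le)
  have h2 : ∏ q ∈ S, Real.log (q : ℝ) ≤ ∏ q ∈ S, (q : ℝ) :=
    Finset.prod_le_prod hlog0 fun q hq => by
      have hq0 : (0 : ℝ) < q := by exact_mod_cast (Nat.prime_of_mem_primeFactors hq).pos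
      exact (Real.log_le_sub_one_of_pos hq0).trans (by linarith)
  have h3 : ∏ q ∈ S, (q : ℝ) < 16 := by
    rw [← radical_cast_eq_prod' (b * c)]; exact_mod_cast hR
  have hP0 : 0 ≤ ∏ q ∈ S, Real.log (q : ℝ) := Finset.prod_nonneg hlog0
  have hK17 : 0 < K ^ 17 := pow_pos (by linarith) 17
  calc 2 * (K ^ (S.card + 1) * ∏ q ∈ S, Real.log (q : ℝ))
      ≤ 2 * (K ^ 17 * ∏ q ∈ S, Real.log (q : ℝ)) := by gcongr
    _ < 2 * (K ^ 17 * 16) := by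
        have := h2.trans_lt h3
        nlinarith
    _ = 32 * K ^ 17 := by ring

/-- `psRate R ≥ (log 2)/3` for `2 ≤ R < 16` (indeed `log⁎₃ ≥ 1`, `log⁎₂ R ≤ 3`, `log R ≥ log 2`). [folklore] -/
private theorem psRate_ge_small {R : ℝ} (h2 : 2 ≤ R) (h16 : R < 16) :
    Real.log 2 / 3 ≤ psRate R := by
  rw [psRate_def]
  have hL2 : Real.log 2 ≤ Real.log R := Real.log_le_log (by norm_num) h2
  have hLpos : 0 < Real.log R := lt_of_lt_of_le (by have := log_two_gt; linarith) hL2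
  have hL3 : Real.log R < 3 :=
    lt_trans (Real.log_lt_log (by linarith) h16) log_sixteen_lt_three
  have hu3 : logStar (Real.log R) ≤ 3 := by
    rw [logStar_def]
    refine max_le (by norm_num) ?_
    have := Real.log_le_sub_one_of_pos hLpos
    linarith
  have hnum : 1 ≤ logStar (Real.log (Real.log R)) := one_le_logStar _
  have hden : 0 < logStar (Real.log R) := logStar_pos' _
  calc Real.log 2 / 3 ≤ Real.log R / logStar (Real.log R) := by
        rw [div_le_div_iff₀ (by norm_num) hden]; nlinarith
    _ = 1 / logStar (Real.log R) * Real.log R := by ring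
    _ ≤ logStar (Real.log (Real.log R)) / logStar (Real.log R) * Real.log R := by
        gcongr

/-! ### Step 4: large radical (`R ≥ 16`): `2Θ ≤ R^{c log₃/log₂} ≤ exp(C · psRate R)` -/

/-- Large radical: for `bc ∣ n ≠ 0` with `rad(n) ≥ 16`, `2Θ_{bc} ≤ exp(C · psRate(rad n))`, from
the Stewart–Yu absorption inequality `habs` (tree `StewartYu2001.absorb`) applied to the primes of
`n`. [cite: StewartYu2001, Theorem 2 (deduction)] -/
private theorem two_theta_le_big {K C : ℝ} (hK : 1 ≤ K) (hC : 0 < C)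
    (habs : ∀ S : Finset ℕ, (∀ q ∈ S, q.Prime) → (6 : ℝ) ≤ ∏ q ∈ S, (q : ℝ) →
      128 * (K ^ (S.card + 1) * ∏ q ∈ S, Real.log ((max 4 q : ℕ) : ℝ)) ^ 2 *
          (S.card : ℝ) ^ 2 * Real.log (∏ q ∈ S, (q : ℝ)) ≤
        (∏ q ∈ S, (q : ℝ)) ^ StewartYu2001.thm2Exponent C (∏ q ∈ S, (q : ℝ)))
    {b c : ℕ} (hb : 0 < b) (hc : 0 < c) (hbc : b.Coprime c) {n : ℕ} (hn : n ≠ 0)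
    (hdvd : b * c ∣ n) (hR : 16 ≤ UniqueFactorizationMonoid.radical (M := ℕ) n) :
    2 * theta K b c 0 ≤
      Real.exp (C * psRate (UniqueFactorizationMonoid.radical (M := ℕ) n : ℕ)) := by
  set S₀ := (b * c).primeFactors with hS₀
  set S := n.primeFactors with hS
  have hsub : S₀ ⊆ S := Nat.primeFactors_mono hdvd hn
  set R : ℝ := ((UniqueFactorizationMonoid.radical (M := ℕ) n : ℕ) : ℝ) with hRdef
  have hRprod : R = ∏ q ∈ S, (q : ℝ) := radical_cast_eq_prod' n
  have hR16 : (16 : ℝ) ≤ R := by rw [hRdef]; exact_mod_cast hR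
  have hRpos : 0 < R := by linarith
  have hK0 : 0 ≤ K := by linarith
  -- `Θ ≤ M := K^{#S+1} ∏_{q ∈ S} log max(4,q)`, `M ≥ 1`
  set M : ℝ := K ^ (S.card + 1) * ∏ q ∈ S, Real.log ((max 4 q : ℕ) : ℝ) with hMdef
  have hlog4 : ∀ q : ℕ, 1 ≤ Real.log ((max 4 q : ℕ) : ℝ) := fun q => by
    have h4 : (4 : ℝ) ≤ ((max 4 q : ℕ) : ℝ) := by exact_mod_cast le_max_left 4 q
    rw [← Real.log_exp 1]
    refine Real.log_le_log (Real.exp_pos 1) (le_trans ?_ h4)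
    have := Real.exp_one_lt_d9; linarith
  have hlog0 : ∀ q ∈ S₀, 0 ≤ Real.log (q : ℝ) := fun q hq =>
    Real.log_nonneg (by exact_mod_cast (Nat.prime_of_mem_primeFactors hq).one_lt.le)
  have hΘM : theta K b c 0 ≤ M := by
    rw [theta_zero_eq K hb.ne' hc.ne' hbc, hMdef]
    have h1 : K ^ (S₀.card + 1) ≤ K ^ (S.card + 1) :=
      pow_le_pow_right₀ hK (by have := Finset.card_le_card hsub; omega)
    have h2 : ∏ q ∈ S₀, Real.log (q : ℝ) ≤ ∏ q ∈ S₀, Real.log ((max 4 q : ℕ) : ℝ) :=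
      Finset.prod_le_prod hlog0 fun q hq => by
        have hq0 : (0 : ℝ) < q := by exact_mod_cast (Nat.prime_of_mem_primeFactors hq).pos
        exact Real.log_le_log hq0 (by exact_mod_cast le_max_right 4 q)
    have h3 : ∏ q ∈ S₀, Real.log ((max 4 q : ℕ) : ℝ) ≤ ∏ q ∈ S, Real.log ((max 4 q : ℕ) : ℝ) :=
      Finset.prod_le_prod_of_subset_of_one_le hsub (fun q _ => zero_le_one.trans (hlog4 q))
        fun q _ _ => hlog4 q
    exact mul_le_mul h1 (h2.trans h3) (Finset.prod_nonneg hlog0) (pow_nonneg hK0 _)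
  have hM1 : 1 ≤ M := by
    rw [hMdef]
    refine one_le_mul_of_one_le_of_one_le (one_le_pow₀ hK) ?_
    calc (1 : ℝ) = ∏ q ∈ S, (1 : ℝ) := by simp
      _ ≤ ∏ q ∈ S, Real.log ((max 4 q : ℕ) : ℝ) :=
          Finset.prod_le_prod (fun _ _ => zero_le_one) fun q _ => hlog4 q
  -- `#S ≥ 1`, `log R ≥ 1`
  have hSne : S.Nonempty := by
    by_contra hne
    rw [Finset.not_nonempty_iff_eq_empty] at hne
    rw [hne, Finset.prod_empty] at hRprod
    linarith
  have hS1 : (1 : ℝ) ≤ S.card := by exact_mod_cast hSne.card_pos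
  have hlogR1 : 1 ≤ Real.log R := by
    rw [← Real.log_exp 1]
    refine Real.log_le_log (Real.exp_pos 1) (le_trans ?_ hR16)
    have := Real.exp_one_lt_d9; linarith
  -- absorb
  have hprime : ∀ q ∈ S, q.Prime := fun q hq => Nat.prime_of_mem_primeFactors hq
  have h6 : (6 : ℝ) ≤ ∏ q ∈ S, (q : ℝ) := by rw [← hRprod]; linarith
  have hA := habs S hprime h6
  rw [← hRprod] at hA
  -- `2Θ ≤ 2M ≤ 128 M² #S² log R`
  have hchain : 2 * theta K b c 0 ≤ 128 * M ^ 2 * (S.card : ℝ) ^ 2 * Real.log R := by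
    have h1 : 2 * theta K b c 0 ≤ 2 * M := by linarith
    have h2 : 2 * M ≤ 128 * M ^ 2 := by nlinarith
    have h3 : 128 * M ^ 2 ≤ 128 * M ^ 2 * (S.card : ℝ) ^ 2 * Real.log R := by
      have hM2 : 0 ≤ 128 * M ^ 2 := by positivity
      calc 128 * M ^ 2 = 128 * M ^ 2 * 1 * 1 := by ring
        _ ≤ 128 * M ^ 2 * (S.card : ℝ) ^ 2 * Real.log R := by
            gcongr
            · nlinarith
    linarith
  -- the exponent: `thm2Exponent C R · log R ≤ C · psRate R`
  have hu1 : 1 ≤ Real.log (Real.log R) := one_le_log_log hR16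
  have hupos : 0 < Real.log (Real.log R) := by linarith
  have hℓ0 : 0 ≤ Real.log (Real.log (Real.log R)) := Real.log_nonneg hu1
  have hexp : StewartYu2001.thm2Exponent C R * Real.log R ≤ C * psRate R := by
    rw [StewartYu2001.thm2Exponent_def, psRate_def, max_eq_left hR16]
    have hden : logStar (Real.log R) = Real.log (Real.log R) := by
      rw [logStar_def, max_eq_right hu1]
    rw [hden]
    have hnum : Real.log (Real.log (Real.log R)) ≤ logStar (Real.log (Real.log R)) := by
      rw [logStar_def]; exact le_max_right _ _
    have hLR : 0 ≤ Real.log R := by linarith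
    calc C * Real.log (Real.log (Real.log R)) / Real.log (Real.log R) * Real.log R
        = C * (Real.log (Real.log (Real.log R)) / Real.log (Real.log R) * Real.log R) := by ring
      _ ≤ C * (logStar (Real.log (Real.log R)) / Real.log (Real.log R) * Real.log R) := by
          gcongr
  calc 2 * theta K b c 0 ≤ 128 * M ^ 2 * (S.card : ℝ) ^ 2 * Real.log R := hchain
    _ ≤ R ^ StewartYu2001.thm2Exponent C R := hA
    _ = Real.exp (StewartYu2001.thm2Exponent C R * Real.log R) := by
        rw [Real.rpow_def_of_pos hRpos, mul_comm]
    _ ≤ Real.exp (C * psRate R) := Real.exp_le_exp.mpr hexp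

/-! ### Assembly -/

/-- **Thm 2.2 with any multiple `n` of `bc` in the radical** (the printed argument run with the
primes of `n ⊇` primes of `bc`; this is the form the `abcd` reduction of §3 consumes). [cite: PastenSepulvedaManzo2025Abcd, Thm. 2.2 (proof, §2)] -/
theorem PastenSepulvedaManzo2025_thm_2_2_general {K : ℝ} (hK : 1 ≤ K)
    (hP : PastenApproximationBound K) :
    ∃ κ : ℝ, 0 < κ ∧ ∀ a b c : ℕ, IsABCTriple a b c → ∀ n : ℕ, n ≠ 0 → b * c ∣ n →
      Real.log ((c : ℝ) / a) / logStar (Real.log c) ≤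
        Real.exp (κ * psRate (UniqueFactorizationMonoid.radical (M := ℕ) n : ℕ)) := by
  obtain ⟨C, hC, habs⟩ := StewartYu2001.absorb hK
  have hK0 : 0 < K := by linarith
  have h32 : (1 : ℝ) ≤ 32 * K ^ 17 := by
    have := one_le_pow₀ (n := 17) hK; linarith
  set κ₀ : ℝ := 5 * Real.log (32 * K ^ 17) + 1 with hκ₀
  have hlog32 : 0 ≤ Real.log (32 * K ^ 17) := Real.log_nonneg h32
  have hκ₀pos : 0 < κ₀ := by rw [hκ₀]; linarith
  refine ⟨max C κ₀, lt_max_of_lt_left hC, fun a b c ht n hn hdvd => ?_⟩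
  have ht' := ht
  obtain ⟨ha, hb, habc, hcop⟩ := ht'
  have hc : 0 < c := by omega
  have hc2 : 2 ≤ c := by omega
  have hbc : b.Coprime c := coprime_right_of_isABCTriple ht
  have hlhs := lhs_lt_two_theta hK hP ht
  set Rn : ℕ := UniqueFactorizationMonoid.radical (M := ℕ) n with hRn
  have hradle : UniqueFactorizationMonoid.radical (M := ℕ) (b * c) ≤ Rn :=
    radical_le_radical_of_dvd hdvd hn
  have hRn2 : 2 ≤ Rn := (two_le_radical hb hc2).trans hradle
  have hR2 : (2 : ℝ) ≤ (Rn : ℝ) := by exact_mod_cast hRn2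
  have hpsR0 : 0 ≤ psRate (Rn : ℝ) := by
    rw [psRate_def]
    exact mul_nonneg (div_nonneg (logStar_pos' _).le (logStar_pos' _).le)
      (Real.log_nonneg (by linarith))
  have hκC : C * psRate (Rn : ℝ) ≤ max C κ₀ * psRate (Rn : ℝ) :=
    mul_le_mul_of_nonneg_right (le_max_left _ _) hpsR0
  have hκ0 : κ₀ * psRate (Rn : ℝ) ≤ max C κ₀ * psRate (Rn : ℝ) :=
    mul_le_mul_of_nonneg_right (le_max_right _ _) hpsR0
  by_cases h16 : 16 ≤ Rn
  · have hbig := two_theta_le_big hK hC habs hb hc hbc hn hdvd h16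
    exact (hlhs.le.trans hbig).trans (Real.exp_le_exp.mpr hκC)
  · push Not at h16
    have hsmall := two_theta_lt_small hK hb hc hbc (lt_of_le_of_lt hradle h16)
    have hR16 : (Rn : ℝ) < 16 := by exact_mod_cast h16
    have hps := psRate_ge_small hR2 hR16
    -- `32 K^17 ≤ exp(κ₀ · psRate R)` since `κ₀ · psRate ≥ 5 log(32K^17) · (log 2 / 3) ≥ log(32 K^17)`
    have hl2 := log_two_gt
    have hkey : Real.log (32 * K ^ 17) ≤ κ₀ * psRate (Rn : ℝ) := by
      have h1 : κ₀ * (Real.log 2 / 3) ≤ κ₀ * psRate (Rn : ℝ) :=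
        mul_le_mul_of_nonneg_left hps hκ₀pos.le
      rw [hκ₀] at h1 ⊢
      nlinarith
    have h2 : 32 * K ^ 17 ≤ Real.exp (κ₀ * psRate (Rn : ℝ)) := by
      calc 32 * K ^ 17 = Real.exp (Real.log (32 * K ^ 17)) := (Real.exp_log (by linarith)).symm
        _ ≤ Real.exp (κ₀ * psRate (Rn : ℝ)) := Real.exp_le_exp.mpr hkey
    exact ((hlhs.trans hsmall).le.trans h2).trans (Real.exp_le_exp.mpr hκ0)

/-- **Pasten–Sepúlveda-Manzo 2025, Thm 2.2** from Pasten's approximation bound with any constant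
`K ≥ 1` (`n = bc`). [cite: PastenSepulvedaManzo2025Abcd, Thm. 2.2 (proof, §2)] -/
theorem PastenSepulvedaManzo2025_thm_2_2_of_approximationBound {K : ℝ} (hK : 1 ≤ K)
    (hP : PastenApproximationBound K) : PastenSepulvedaManzo2025_thm_2_2 := by
  obtain ⟨κ, hκ, h⟩ := PastenSepulvedaManzo2025_thm_2_2_general hK hP
  refine ⟨κ, hκ, fun a b c ht => h a b c ht (b * c) ?_ dvd_rfl⟩
  obtain ⟨ha, hb, habc, -⟩ := ht
  have hc : 0 < c := by omega
  positivity

/-- From Evertse–Győry 4.2.1 over `ℚ`. [cite: PastenSepulvedaManzo2025Abcd, Thm. 2.2 (proof, §2)] -/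
theorem PastenSepulvedaManzo2025_thm_2_2_of_evertseGyory (hEG : evertseGyory_thm_4_2_1_rat) :
    PastenSepulvedaManzo2025_thm_2_2 :=
  PastenSepulvedaManzo2025_thm_2_2_of_approximationBound one_le_pastenK (pasten2024_thm_2_1 hEG)

/-! ### Thm 1.3 from Evertse–Győry -/

/-- **Thm 1.3 with any multiple `n` of `bc` in the radical** (from the general form of Thm 2.2; the
printed one-line proof of Thm 1.3, §2). [cite: PastenSepulvedaManzo2025Abcd, Thm. 1.3 (proof, end of §2)] -/
theorem PastenSepulvedaManzo2025_thm_1_3_general {K : ℝ} (hK : 1 ≤ K)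
    (hP : PastenApproximationBound K) :
    ∃ κ : ℝ, 0 < κ ∧ ∀ a b c : ℕ, IsABCTriple a b c → ∀ τ : ℝ, 0 < τ →
      (a : ℝ) ≤ c / Real.exp ((Real.log c) ^ τ * logStar (Real.log c)) →
        ∀ n : ℕ, n ≠ 0 → b * c ∣ n →
          Real.log c ≤
            Real.exp (τ⁻¹ * κ * psRate (UniqueFactorizationMonoid.radical (M := ℕ) n : ℕ)) := by
  obtain ⟨κ, hκ, hb⟩ := PastenSepulvedaManzo2025_thm_2_2_general hK hP
  refine ⟨κ, hκ, fun a b c ht τ hτ hsmall n hn hdvd => ?_⟩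
  obtain ⟨ha, hb0, habc, hcop⟩ := ht
  set R : ℕ := UniqueFactorizationMonoid.radical (M := ℕ) n with hR
  set m : ℝ := logStar (Real.log c) with hm
  set E : ℝ := Real.exp (κ * psRate (R : ℕ)) with hE
  have hmpos : 0 < m := lt_of_lt_of_le one_pos (one_le_logStar _)
  have ha' : (0 : ℝ) < a := by exact_mod_cast ha
  have hc1 : (1 : ℝ) < c := by exact_mod_cast (show 1 < c by omega)
  have hc0 : (0 : ℝ) < c := by linarith
  have hlogc : 0 < Real.log c := Real.log_pos hc1
  have hexp_pos : 0 < Real.exp ((Real.log c) ^ τ * m) := Real.exp_pos _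
  have h1 : Real.exp ((Real.log c) ^ τ * m) ≤ (c : ℝ) / a := by
    rw [le_div_iff₀ ha']
    have := mul_le_mul_of_nonneg_right hsmall hexp_pos.le
    rw [div_mul_cancel₀ _ hexp_pos.ne'] at this
    linarith [mul_comm (a : ℝ) (Real.exp ((Real.log c) ^ τ * m))]
  have hca : 0 < (c : ℝ) / a := div_pos hc0 ha'
  have h2 : (Real.log c) ^ τ * m ≤ Real.log ((c : ℝ) / a) :=
    (Real.le_log_iff_exp_le hca).mpr h1
  have h3 : Real.log ((c : ℝ) / a) / m ≤ E := hb a b c ⟨ha, hb0, habc, hcop⟩ n hn hdvd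
  have h3' : Real.log ((c : ℝ) / a) ≤ E * m := by rwa [div_le_iff₀ hmpos] at h3
  have h4 : (Real.log c) ^ τ ≤ E := le_of_mul_le_mul_right (h2.trans h3') hmpos
  have h5 : ((Real.log c) ^ τ) ^ τ⁻¹ ≤ E ^ τ⁻¹ :=
    Real.rpow_le_rpow (Real.rpow_nonneg hlogc.le τ) h4 (inv_nonneg.mpr hτ.le)
  rw [Real.rpow_rpow_inv hlogc.le hτ.ne'] at h5
  calc Real.log c ≤ E ^ τ⁻¹ := h5
    _ = Real.exp (τ⁻¹ * κ * psRate (R : ℕ)) := by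
        rw [hE, ← Real.exp_mul]; ring_nf

/-- **Pasten–Sepúlveda-Manzo 2025, Thm 1.3 from Evertse–Győry's Thm 4.2.1 over `ℚ`** (the named
fact `PastenSepulvedaManzo2025_thm_1_3` PROVED relative to the single pre-existing named fact
`Dioph.evertseGyory_thm_4_2_1_rat`). [cite: PastenSepulvedaManzo2025Abcd, Thm. 1.3 (§1.2; proof §2)] -/
theorem PastenSepulvedaManzo2025_thm_1_3_of_evertseGyory (hEG : evertseGyory_thm_4_2_1_rat) :
    PastenSepulvedaManzo2025_thm_1_3 :=
  PastenSepulvedaManzo2025_thm_1_3_of_thm_2_2 (PastenSepulvedaManzo2025_thm_2_2_of_evertseGyory hEG)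

/-! ### Thm 1.6 (the `abcd` equation) from Thm 1.3 (§3) -/

/-- The key case of the printed reduction (§3): the small pair is `{p, q}` and `H = |x_p|`; then
`(a, b, c) = (|x_p + x_q|, |x_q|, |x_p|)` is an `abc` triple satisfying (1.3), `bc ∣ ∏ |x_k|`, and
Thm 1.3 (general-`n` form) applies; `x_p + x_q = 0` forces `H = 1`. [cite: PastenSepulvedaManzo2025Abcd, Thm. 1.6 (proof, §3)] -/
private theorem abcd_key {κ : ℝ}
    (h13 : ∀ a b c : ℕ, IsABCTriple a b c → ∀ τ : ℝ, 0 < τ →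
      (a : ℝ) ≤ c / Real.exp ((Real.log c) ^ τ * logStar (Real.log c)) →
        ∀ n : ℕ, n ≠ 0 → b * c ∣ n →
          Real.log c ≤
            Real.exp (τ⁻¹ * κ * psRate (UniqueFactorizationMonoid.radical (M := ℕ) n : ℕ)))
    (x : Fin 4 → ℤ) (hx : ∀ i, x i ≠ 0) (hcop : Pairwise fun i j => IsCoprime (x i) (x j))
    {τ : ℝ} (hτ : 0 < τ) {p q : Fin 4} (hpq : p ≠ q)
    (hH : (Finset.univ.sup fun k => (x k).natAbs) = (x p).natAbs)
    (hsmall : |((x p + x q : ℤ) : ℝ)| ≤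
      (Finset.univ.sup fun k => (x k).natAbs : ℕ) /
        Real.exp ((Real.log (Finset.univ.sup fun k => (x k).natAbs : ℕ)) ^ τ *
          logStar (Real.log (Finset.univ.sup fun k => (x k).natAbs : ℕ)))) :
    Real.log (Finset.univ.sup fun k => (x k).natAbs : ℕ) ≤
      Real.exp (τ⁻¹ * κ *
        psRate (UniqueFactorizationMonoid.radical (M := ℕ) (∏ k, (x k).natAbs) : ℕ)) := by
  rw [hH] at hsmall ⊢
  by_cases hy : x p + x q = 0
  · -- degenerate: `x_q = -x_p` coprime to `x_p` forces `|x_p| = 1`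
    have hunit : IsUnit (x p) := by
      have hq : x q = -x p := by linarith
      have : IsCoprime (x p) (x q) := hcop hpq
      rw [hq] at this
      exact isCoprime_self.mp (by simpa using this.neg_right)
    rw [Int.isUnit_iff_natAbs_eq.mp hunit]
    simp only [Nat.cast_one, Real.log_one]
    positivity
  · have hc1 : 1 ≤ (x p).natAbs := Int.natAbs_pos.mpr (hx p)
    have hc1' : (1 : ℝ) ≤ ((x p).natAbs : ℕ) := by exact_mod_cast hc1
    have hqmax : (x q).natAbs ≤ (x p).natAbs :=
      hH ▸ Finset.le_sup (f := fun k => (x k).natAbs) (Finset.mem_univ q)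
    have hE : 0 ≤ (Real.log ((x p).natAbs : ℕ)) ^ τ * logStar (Real.log ((x p).natAbs : ℕ)) :=
      mul_nonneg (Real.rpow_nonneg (Real.log_nonneg hc1') τ)
        (zero_le_one.trans (one_le_logStar _))
    have hcast : (((x p + x q).natAbs : ℕ) : ℝ) = |((x p + x q : ℤ) : ℝ)| := by
      rw [Nat.cast_natAbs, Int.cast_abs]
    have hac : (x p + x q).natAbs ≤ (x p).natAbs := by
      have h2 : |((x p + x q : ℤ) : ℝ)| ≤ ((x p).natAbs : ℕ) :=
        hsmall.trans (div_le_self (Nat.cast_nonneg _) (Real.one_le_exp hE))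
      rw [← hcast] at h2
      exact_mod_cast h2
    have habc : IsABCTriple (x p + x q).natAbs (x q).natAbs (x p).natAbs := by
      refine ⟨Int.natAbs_pos.mpr hy, Int.natAbs_pos.mpr (hx q), by omega, ?_⟩
      have hc : IsCoprime (x p) (x q) := hcop hpq
      exact Int.isCoprime_iff_gcd_eq_one.mp (by simpa using hc.add_mul_left_left 1)
    have hn : (∏ k, (x k).natAbs) ≠ 0 :=
      Finset.prod_ne_zero_iff.mpr fun k _ => Int.natAbs_ne_zero.mpr (hx k)
    have hdvd : (x q).natAbs * (x p).natAbs ∣ ∏ k, (x k).natAbs := by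
      rw [← Finset.prod_pair (f := fun k => (x k).natAbs) hpq.symm]
      exact Finset.prod_dvd_prod_of_subset _ _ _ (Finset.subset_univ _)
    have hsmall' : (((x p + x q).natAbs : ℕ) : ℝ) ≤ ((x p).natAbs : ℕ) /
        Real.exp ((Real.log ((x p).natAbs : ℕ)) ^ τ * logStar (Real.log ((x p).natAbs : ℕ))) := by
      rw [hcast]; exact hsmall
    exact h13 _ _ _ habc τ hτ hsmall' _ hn hdvd

/-- **Thm 1.6 from Pasten's approximation bound** (any `K ≥ 1`): the printed reduction (§3) to
Thm 1.3 — w.l.o.g. the small pair is `{x₁, x₂}`; if `H = |x₁|` (or `|x₂|`) apply the key case, and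
if `H = |x₃|` (or `|x₄|`) use `|x₁ + x₂| = |x₃ + x₄|` first; the radical is handled by the
general-`n` form of Thm 1.3 (`x_q x_p ∣ ∏ x_k`), so no monotonicity of `psRate` is needed.
[cite: PastenSepulvedaManzo2025Abcd, Thm. 1.6 (§1.4; proof §3)] -/
theorem PastenSepulvedaManzo2025_thm_1_6_of_approximationBound {K : ℝ} (hK : 1 ≤ K)
    (hP : PastenApproximationBound K) : PastenSepulvedaManzo2025_thm_1_6 := by
  obtain ⟨κ, hκ, h13⟩ := PastenSepulvedaManzo2025_thm_1_3_general hK hP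
  refine ⟨κ, hκ, fun x hx hcop hsum τ hτ hpair => ?_⟩
  obtain ⟨i, j, hij, hsmall⟩ := hpair
  obtain ⟨m, -, hm⟩ :=
    Finset.exists_mem_eq_sup Finset.univ Finset.univ_nonempty (fun k => (x k).natAbs)
  by_cases hmi : m = i
  · exact abcd_key h13 x hx hcop hτ hij (by rw [hm, hmi]) hsmall
  by_cases hmj : m = j
  · rw [add_comm] at hsmall
    exact abcd_key h13 x hx hcop hτ hij.symm (by rw [hm, hmj]) hsmall
  -- `H = |x_m|` with `m ∉ {i, j}`: the complementary pair `{m, l}` has the same sum up to sign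
  have him : i ≠ m := fun h => hmi h.symm
  have hjm : j ≠ m := fun h => hmj h.symm
  have h3 : ({i, j, m} : Finset (Fin 4)).card = 3 :=
    Finset.card_eq_three.mpr ⟨i, j, m, hij, him, hjm, rfl⟩
  obtain ⟨l, hl⟩ : ∃ l, ({i, j, m} : Finset (Fin 4))ᶜ = {l} :=
    Finset.card_eq_one.mp (by rw [Finset.card_compl, h3]; rfl)
  have hls : l ∉ ({i, j, m} : Finset (Fin 4)) := by
    rw [← Finset.mem_compl, hl]; exact Finset.mem_singleton_self l
  have hml : m ≠ l := by
    rintro rfl; exact hls (by simp)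
  have hs : ∑ k ∈ ({i, j, m} : Finset (Fin 4)), x k = x i + x j + x m := by
    rw [Finset.sum_insert (by simp [hij, him]), Finset.sum_insert (by simpa using hjm),
      Finset.sum_singleton]
    ring
  have hsc : ∑ k ∈ ({i, j, m} : Finset (Fin 4))ᶜ, x k = x l := by
    rw [hl, Finset.sum_singleton]
  have hml_sum : x m + x l = -(x i + x j) := by
    have := Finset.sum_add_sum_compl ({i, j, m} : Finset (Fin 4)) x
    rw [hs, hsc, hsum] at this
    linarith
  have hsmall' : |((x m + x l : ℤ) : ℝ)| ≤
      (Finset.univ.sup fun k => (x k).natAbs : ℕ) /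
        Real.exp ((Real.log (Finset.univ.sup fun k => (x k).natAbs : ℕ)) ^ τ *
          logStar (Real.log (Finset.univ.sup fun k => (x k).natAbs : ℕ))) := by
    rw [hml_sum, Int.cast_neg, abs_neg]; exact hsmall
  exact abcd_key h13 x hx hcop hτ hml hm hsmall'

/-- **Pasten–Sepúlveda-Manzo 2025, Thm 1.6 from Evertse–Győry's Thm 4.2.1 over `ℚ`** (the named
fact `PastenSepulvedaManzo2025_thm_1_6` PROVED relative to the single pre-existing named fact
`Dioph.evertseGyory_thm_4_2_1_rat`). [cite: PastenSepulvedaManzo2025Abcd, Thm. 1.6 (§1.4; proof §3)] -/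
theorem PastenSepulvedaManzo2025_thm_1_6_of_evertseGyory (hEG : evertseGyory_thm_4_2_1_rat) :
    PastenSepulvedaManzo2025_thm_1_6 :=
  PastenSepulvedaManzo2025_thm_1_6_of_approximationBound one_le_pastenK (pasten2024_thm_2_1 hEG)

end Literature.NumberTheory.DiophantineGeometry

end
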